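import Mathlib
import Summits.ValiantsHypothesis.ValiantsHypothesis.Theorems.NewtonUnitEquationsDissociatedUniformGenericCount
import Summits.ValiantsHypothesis.ValiantsHypothesis.Theorems.NewtonUnitEquationsDissociatedUniformGenericGaps
import Summits.ValiantsHypothesis.ValiantsHypothesis.Theorems.NewtonUnitEquationsDissociatedUniformGenericMenus

/-!
# Generic stratum of crux `DissociatedUniform` — the code of a top-`k` word

Crux stmt-ValiantsHypothesis-5905 (`NewtonUnitEquations.DissociatedUniform`), line `greedy-basis-shadow`, by-product
"generic stratum" (lead c5).  The code of a word `a`: the number `d` of demoted coordinates, the sorted gaps of the set of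
their coordinate ranks (padded to length `N`), and their letter ranks in the same order.  A word with fewer than `k`
strictly higher words has `d ≤ log₂ k` and both tuples in `Tset N k` (the two menus), and the code is injective on the
words of the box with at most `N` demoted coordinates.  Hence (`ncard_topWords_le`) the words of the box that are
top-`k` for SOME height comparison-equivalent to `φ` number at most `(log₂ k + 1) · (2^N k²)²`, `N = log₂ k + 1`.
[folklore shape]
-/

open scoped BigOperators

-- Sub = Summit single-conjunct layout: the duplicated namespace component is mandated by the tree.
set_option linter.dupNamespace false

namespace Summit.ValiantsHypothesis.ValiantsHypothesis.Theorems.NewtonUnitEquationsDissociatedUniform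

namespace Generic

noncomputable section

variable {ι L : Type} [Fintype ι] [DecidableEq ι] [Inhabited L] [DecidableEq L]

variable {A : ι → Finset L} {φ : L → ℝ}

/-- The rank set has as many elements as there are demoted coordinates. -/
theorem card_Rset (hinj : Set.InjOn (Hw φ) (Fintype.piFinset A : Set (ι → L))) (hne : ∀ j, (A j).Nonempty)
    {a : ι → L} (ha : a ∈ Fintype.piFinset A) : (Rset A φ a).card = (dem A φ a).card :=
  Finset.card_image_of_injOn fun j hj j' hj' h =>
    crank_injOn_big hinj hne (dem_subset_big A φ ha j (Finset.mem_coe.mp hj))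
      (dem_subset_big A φ ha j' (Finset.mem_coe.mp hj')) h

/-- `crank` is injective on the demoted set. -/
theorem crank_injOn_dem (hinj : Set.InjOn (Hw φ) (Fintype.piFinset A : Set (ι → L))) (hne : ∀ j, (A j).Nonempty)
    {a : ι → L} (ha : a ∈ Fintype.piFinset A) : Set.InjOn (crank A φ) (dem A φ a : Set ι) :=
  fun j hj j' hj' h => crank_injOn_big hinj hne (dem_subset_big A φ ha j (Finset.mem_coe.mp hj))
    (dem_subset_big A φ ha j' (Finset.mem_coe.mp hj')) h

/-- At the rank of a demoted coordinate, `lrankAt` is its letter rank. -/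
theorem lrankAt_crank (hinj : Set.InjOn (Hw φ) (Fintype.piFinset A : Set (ι → L))) (hne : ∀ j, (A j).Nonempty)
    {a : ι → L} (ha : a ∈ Fintype.piFinset A) {j : ι} (hj : j ∈ dem A φ a) :
    lrankAt A φ a (crank A φ j) = lrank A φ a j := by
  unfold lrankAt
  have hfilter : (dem A φ a).filter (fun j' => crank A φ j' = crank A φ j) = {j} := by
    ext j'
    simp only [Finset.mem_filter, Finset.mem_singleton]
    constructor
    · rintro ⟨hj', h⟩
      exact crank_injOn_dem hinj hne ha (Finset.mem_coe.mpr hj') (Finset.mem_coe.mpr hj) h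
    · rintro rfl; exact ⟨hj, rfl⟩
  rw [hfilter, Finset.sum_singleton]

/-- **Ranks and gaps.**  For a demoted coordinate `j`, the unordered gap of `crank j` in the rank set is `|G a j| + 1`. -/
theorem ugap_Rset (hinj : Set.InjOn (Hw φ) (Fintype.piFinset A : Set (ι → L))) (hne : ∀ j, (A j).Nonempty)
    {a : ι → L} (ha : a ∈ Fintype.piFinset A) {j : ι} (hj : j ∈ dem A φ a) :
    ugap (Rset A φ a) (crank A φ j) = (G A φ a j).card + 1 := by
  have hjbig := dem_subset_big A φ ha j hj
  -- surjectivity of `crank` below `crank j`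
  have hsurj : ∀ n, n < crank A φ j → ∃ c, ((A c).erase (top A φ c)).Nonempty ∧ bestw A φ c < bestw A φ j ∧ crank A φ c = n := by
    intro n hn
    set B := Finset.univ.filter (fun c => ((A c).erase (top A φ c)).Nonempty ∧ bestw A φ c < bestw A φ j) with hB
    have hcardB : B.card = crank A φ j := rfl
    have himg : B.image (crank A φ) ⊆ Finset.range (crank A φ j) := by
      intro r hr
      obtain ⟨c, hc, rfl⟩ := Finset.mem_image.mp hr
      have hc := Finset.mem_filter.mp hc
      exact Finset.mem_range.mpr (crank_lt_crank hc.2.1 hc.2.2)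
    have hinjB : Set.InjOn (crank A φ) (B : Set ι) := fun c hc c' hc' h =>
      crank_injOn_big hinj hne (Finset.mem_filter.mp (Finset.mem_coe.mp hc)).2.1
        (Finset.mem_filter.mp (Finset.mem_coe.mp hc')).2.1 h
    have heq : B.image (crank A φ) = Finset.range (crank A φ j) :=
      Finset.eq_of_subset_of_card_le himg (by rw [Finset.card_range, Finset.card_image_of_injOn hinjB, hcardB])
    have hn' : n ∈ B.image (crank A φ) := by rw [heq]; exact Finset.mem_range.mpr hn
    obtain ⟨c, hc, hcn⟩ := Finset.mem_image.mp hn'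
    have hc := Finset.mem_filter.mp hc
    exact ⟨c, hc.2.1, hc.2.2, hcn⟩
  -- the filter defining `ugap` is `insert (crank j) (crank '' G a j)`
  have hset : (Finset.range (crank A φ j + 1)).filter
      (fun n => ∀ r' ∈ Rset A φ a, r' < crank A φ j → r' < n) = insert (crank A φ j) ((G A φ a j).image (crank A φ)) := by
    ext n
    simp only [Finset.mem_filter, Finset.mem_range, Finset.mem_insert, Finset.mem_image]
    constructor
    · rintro ⟨hn, hP⟩
      rcases (Nat.le_of_lt_succ hn).lt_or_eq with hlt | heq
      · right
        obtain ⟨c, hcbig, hclt, hcn⟩ := hsurj n hlt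
        refine ⟨c, mem_G.mpr ⟨hcbig, hclt, fun j' hj' hlt' => ?_⟩, hcn⟩
        have hj'big := dem_subset_big A φ ha j' hj'
        have h1 : crank A φ j' < crank A φ j := crank_lt_crank hj'big hlt'
        have h2 : crank A φ j' < n :=
          hP _ (Finset.mem_image.mpr ⟨j', hj', rfl⟩) h1
        rw [← hcn] at h2
        exact (crank_lt_crank_iff hinj hne hj'big hcbig).mp h2
      · left; exact heq
    · rintro (rfl | ⟨c, hc, rfl⟩)
      · exact ⟨Nat.lt_succ_self _, fun r' _ h => h⟩
      · have hc := mem_G.mp hc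
        refine ⟨Nat.lt_succ_of_lt (crank_lt_crank hc.1 hc.2.1), fun r' hr' hlt => ?_⟩
        obtain ⟨j', hj', rfl⟩ := Finset.mem_image.mp hr'
        have hj'big := dem_subset_big A φ ha j' hj'
        have h1 : bestw A φ j' < bestw A φ j := (crank_lt_crank_iff hinj hne hj'big hjbig).mp hlt
        exact crank_lt_crank hj'big (hc.2.2 j' hj' h1)
  unfold ugap
  rw [hset, Finset.card_insert_of_notMem, Finset.card_image_of_injOn]
  · exact fun c hc c' hc' h => crank_injOn_big hinj hne (mem_G.mp (Finset.mem_coe.mp hc)).1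
      (mem_G.mp (Finset.mem_coe.mp hc')).1 h
  · intro hmem
    obtain ⟨c, hc, hcj⟩ := Finset.mem_image.mp hmem
    have hc := mem_G.mp hc
    exact absurd hcj (crank_lt_crank hc.1 hc.2.1).ne

/-- The gap product of the rank set is at most `k` for a top-`k` word. -/
theorem prod_ugap_Rset_le {ψ : L → ℝ}
    (hc : ∀ (j j' : ι), ∀ l₁ ∈ A j, ∀ l₂ ∈ A j, ∀ l₃ ∈ A j', ∀ l₄ ∈ A j',
      (φ l₁ - φ l₂ < φ l₃ - φ l₄ ↔ ψ l₁ - ψ l₂ < ψ l₃ - ψ l₄))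
    (hinj : Set.InjOn (Hw φ) (Fintype.piFinset A : Set (ι → L))) (hne : ∀ j, (A j).Nonempty)
    {a : ι → L} (ha : a ∈ Fintype.piFinset A) {k : ℕ}
    (hk : ((Fintype.piFinset A).filter fun b => Hw ψ a < Hw ψ b).card < k) :
    ∏ r ∈ Rset A φ a, ugap (Rset A φ a) r ≤ k := by
  unfold Rset
  rw [Finset.prod_image (crank_injOn_dem hinj hne ha)]
  calc ∏ j ∈ dem A φ a, ugap ((dem A φ a).image (crank A φ)) (crank A φ j)
      = ∏ j ∈ dem A φ a, ((G A φ a j).card + 1) := Finset.prod_congr rfl fun j hj => ugap_Rset hinj hne ha hj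
    _ ≤ k := prod_G_le hc hinj hne ha hk

/-- A padded product over `Fin N` of a function vanishing from `d ≤ N` on equals the product over `range d`. -/
theorem prod_fin_pad {N d : ℕ} (hd : d ≤ N) (f : ℕ → ℕ) (hf : ∀ n, d ≤ n → f n = 0) :
    ∏ s : Fin N, (1 + f s) = ∏ n ∈ Finset.range d, (1 + f n) := by
  rw [Fin.prod_univ_eq_prod_range (fun n => 1 + f n) N]
  symm
  refine Finset.prod_subset (Finset.range_subset_range.mpr hd) fun n _ hn => ?_
  rw [hf n (not_lt.mp fun h => hn (Finset.mem_range.mpr h)), add_zero]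

/-- The gap code of a top-`k` word lies in `Tset N k` (when `N` bounds the number of demoted coordinates). -/
theorem gcode_mem_Tset {ψ : L → ℝ}
    (hc : ∀ (j j' : ι), ∀ l₁ ∈ A j, ∀ l₂ ∈ A j, ∀ l₃ ∈ A j', ∀ l₄ ∈ A j',
      (φ l₁ - φ l₂ < φ l₃ - φ l₄ ↔ ψ l₁ - ψ l₂ < ψ l₃ - ψ l₄))
    (hinj : Set.InjOn (Hw φ) (Fintype.piFinset A : Set (ι → L))) (hne : ∀ j, (A j).Nonempty)
    {a : ι → L} (ha : a ∈ Fintype.piFinset A) {k N : ℕ} (hN : (dem A φ a).card ≤ N)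
    (hk : ((Fintype.piFinset A).filter fun b => Hw ψ a < Hw ψ b).card < k) : gcode N A φ a ∈ Tset N k := by
  refine (mem_Tset _).mpr ?_
  have hcard : (Rset A φ a).card ≤ N := (Finset.card_image_le).trans hN
  have h := prod_fin_pad hcard (fun n => gapN (Rset A φ a) n) fun n hn => gapN_eq_zero_of_le _ hn
  calc ∏ s : Fin N, (1 + gcode N A φ a s) = ∏ n ∈ Finset.range (Rset A φ a).card, (1 + gapN (Rset A φ a) n) := h
    _ = ∏ r ∈ Rset A φ a, ugap (Rset A φ a) r := (prod_ugap _).symm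
    _ ≤ k := prod_ugap_Rset_le hc hinj hne ha hk

/-- The letter-rank code of a top-`k` word lies in `Tset N k`. -/
theorem lcode_mem_Tset {ψ : L → ℝ}
    (hc : ∀ (j j' : ι), ∀ l₁ ∈ A j, ∀ l₂ ∈ A j, ∀ l₃ ∈ A j', ∀ l₄ ∈ A j',
      (φ l₁ - φ l₂ < φ l₃ - φ l₄ ↔ ψ l₁ - ψ l₂ < ψ l₃ - ψ l₄))
    (hinj : Set.InjOn (Hw φ) (Fintype.piFinset A : Set (ι → L))) (hne : ∀ j, (A j).Nonempty)
    (hψ : Set.InjOn (Hw ψ) (Fintype.piFinset A : Set (ι → L)))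
    {a : ι → L} (ha : a ∈ Fintype.piFinset A) {k N : ℕ} (hN : (dem A φ a).card ≤ N)
    (hk : ((Fintype.piFinset A).filter fun b => Hw ψ a < Hw ψ b).card < k) : lcode N A φ a ∈ Tset N k := by
  refine (mem_Tset _).mpr ?_
  have ha' := Fintype.mem_piFinset.mp ha
  have hφA : ∀ j, Set.InjOn φ (A j : Set L) := fun j => phi_injOn A φ hinj ha j
  have hcard : (Rset A φ a).card ≤ N := (Finset.card_image_le).trans hN
  set f : ℕ → ℕ := fun n => if n < (Rset A φ a).card then lrankAt A φ a (enumN (Rset A φ a) n) else 0 with hf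
  have hpad := prod_fin_pad hcard f fun n hn => by simp only [hf, if_neg (not_lt.mpr hn)]
  have h1 : ∏ n ∈ Finset.range (Rset A φ a).card, (1 + f n) =
      ∏ n ∈ Finset.range (Rset A φ a).card, (1 + lrankAt A φ a (enumN (Rset A φ a) n)) :=
    Finset.prod_congr rfl fun n hn => by simp only [hf, if_pos (Finset.mem_range.mp hn)]
  have h2 : ∏ n ∈ Finset.range (Rset A φ a).card, (1 + lrankAt A φ a (enumN (Rset A φ a) n)) =
      ∏ r ∈ Rset A φ a, (1 + lrankAt A φ a r) := prod_range_enumN (Rset A φ a) fun r => 1 + lrankAt A φ a r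
  have h3 : ∏ r ∈ Rset A φ a, (1 + lrankAt A φ a r) = ∏ j ∈ dem A φ a, (U A φ a j).card := by
    unfold Rset
    rw [Finset.prod_image (crank_injOn_dem hinj hne ha)]
    refine Finset.prod_congr rfl fun j hj => ?_
    rw [lrankAt_crank hinj hne ha hj, card_U hφA (ha' j), add_comm]
  have h4 : ∏ j ∈ dem A φ a, (U A φ a j).card ≤ ∏ j, (U A φ a j).card :=
    Finset.prod_le_prod_of_subset_of_one_le' (Finset.subset_univ _) fun j _ _ =>
      Finset.card_pos.mpr ⟨a j, Finset.mem_filter.mpr ⟨ha' j, le_rfl⟩⟩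
  calc ∏ s : Fin N, (1 + lcode N A φ a s) = ∏ s : Fin N, (1 + f s) := rfl
    _ = _ := hpad
    _ ≤ k := by rw [h1, h2, h3]; exact h4.trans (prod_card_U_le hc hψ ha hk)

/-- A top-`k` word has at most `log₂ k` demoted coordinates. -/
theorem card_dem_le_log {ψ : L → ℝ}
    (hc : ∀ (j j' : ι), ∀ l₁ ∈ A j, ∀ l₂ ∈ A j, ∀ l₃ ∈ A j', ∀ l₄ ∈ A j',
      (φ l₁ - φ l₂ < φ l₃ - φ l₄ ↔ ψ l₁ - ψ l₂ < ψ l₃ - ψ l₄))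
    (hinj : Set.InjOn (Hw φ) (Fintype.piFinset A : Set (ι → L)))
    (hψ : Set.InjOn (Hw ψ) (Fintype.piFinset A : Set (ι → L)))
    {a : ι → L} (ha : a ∈ Fintype.piFinset A) {k : ℕ}
    (hk : ((Fintype.piFinset A).filter fun b => Hw ψ a < Hw ψ b).card < k) : (dem A φ a).card ≤ Nat.log 2 k := by
  have ha' := Fintype.mem_piFinset.mp ha
  have hφA : ∀ j, Set.InjOn φ (A j : Set L) := fun j => phi_injOn A φ hinj ha j
  refine Nat.le_log_of_pow_le one_lt_two ?_
  calc 2 ^ (dem A φ a).card = ∏ _j ∈ dem A φ a, 2 := by simp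
    _ ≤ ∏ j ∈ dem A φ a, (U A φ a j).card := Finset.prod_le_prod' fun j hj => by
        rw [card_U hφA (ha' j)]; have := one_le_lrank hφA (ha' j) hj; omega
    _ ≤ ∏ j, (U A φ a j).card :=
        Finset.prod_le_prod_of_subset_of_one_le' (Finset.subset_univ _) fun j _ _ =>
          Finset.card_pos.mpr ⟨a j, Finset.mem_filter.mpr ⟨ha' j, le_rfl⟩⟩
    _ ≤ k := prod_card_U_le hc hψ ha hk

/-- **Injectivity of the code** on the words of the box with at most `N` demoted coordinates. -/
theorem code_injOn (hinj : Set.InjOn (Hw φ) (Fintype.piFinset A : Set (ι → L))) (hne : ∀ j, (A j).Nonempty) (N : ℕ) :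
    Set.InjOn (fun a => ((dem A φ a).card, gcode N A φ a, lcode N A φ a))
      {a : ι → L | a ∈ Fintype.piFinset A ∧ (dem A φ a).card ≤ N} := by
  intro a ha a' ha' h
  obtain ⟨habox, haN⟩ := ha
  obtain ⟨ha'box, ha'N⟩ := ha'
  simp only [Prod.mk.injEq] at h
  obtain ⟨hd, hg, hl⟩ := h
  have haa := Fintype.mem_piFinset.mp habox
  have haa' := Fintype.mem_piFinset.mp ha'box
  have hφA : ∀ j, Set.InjOn φ (A j : Set L) := fun j => phi_injOn A φ hinj habox j
  have hRc : (Rset A φ a).card = (dem A φ a).card := card_Rset hinj hne habox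
  have hRc' : (Rset A φ a').card = (dem A φ a').card := card_Rset hinj hne ha'box
  -- equal rank sets
  have hR : Rset A φ a = Rset A φ a' := by
    refine eq_of_gapN_eq (by rw [hRc, hRc', hd]) fun n hn => ?_
    have hnN : n < N := lt_of_lt_of_le hn (hRc ▸ haN)
    exact congrFun hg ⟨n, hnN⟩
  -- equal demoted sets
  have hdem : dem A φ a = dem A φ a' := by
    have key : ∀ {b b' : ι → L}, b ∈ Fintype.piFinset A → b' ∈ Fintype.piFinset A → Rset A φ b = Rset A φ b' →
        dem A φ b ⊆ dem A φ b' := by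
      intro b b' hb hb' hRR j hj
      have : crank A φ j ∈ Rset A φ b' := hRR ▸ Finset.mem_image_of_mem _ hj
      obtain ⟨j', hj', hjj'⟩ := Finset.mem_image.mp this
      rwa [← crank_injOn_big hinj hne (dem_subset_big A φ hb' j' hj') (dem_subset_big A φ hb j hj) hjj']
    exact Finset.Subset.antisymm (key habox ha'box hR) (key ha'box habox hR.symm)
  funext j
  by_cases hj : j ∈ dem A φ a
  · have hj' : j ∈ dem A φ a' := hdem ▸ hj
    obtain ⟨n, hn, hnj⟩ := exists_enumN_eq (Rset A φ a) (Finset.mem_image_of_mem (crank A φ) hj)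
    have hnN : n < N := lt_of_lt_of_le hn (hRc ▸ haN)
    have h1 := congrFun hl ⟨n, hnN⟩
    simp only [lcode, if_pos hn, ← hR, hnj] at h1
    rw [lrankAt_crank hinj hne habox hj] at h1
    have h2 : lrankAt A φ a' (crank A φ j) = lrank A φ a' j := lrankAt_crank hinj hne ha'box hj'
    rw [h2] at h1
    exact eq_of_lrank_eq hφA (haa j) (haa' j) h1
  · have hj' : j ∉ dem A φ a' := hdem ▸ hj
    rw [not_not.mp (mt (mem_dem A φ).mpr hj), not_not.mp (mt (mem_dem A φ).mpr hj')]

/-- The size of the code space. -/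
theorem card_codeSpace_le (k N : ℕ) : (codeSpace k N).card ≤ (Nat.log 2 k + 1) * (2 ^ N * k ^ 2) ^ 2 := by
  unfold codeSpace
  rw [Finset.card_product, Finset.card_product, Finset.card_range, sq (2 ^ N * k ^ 2)]
  exact Nat.mul_le_mul_left _ (Nat.mul_le_mul (card_Tset_le N k) (card_Tset_le N k))

/-- **Counting top-`k` words.**  The words of the box that are top-`k` for SOME word-height-injective height `ψ`
comparison-equivalent to `φ` (itself word-height-injective) number at most `|codeSpace k (log₂ k + 1)|`. -/
theorem ncard_topWords_le (hinj : Set.InjOn (Hw φ) (Fintype.piFinset A : Set (ι → L))) (hne : ∀ j, (A j).Nonempty)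
    (k : ℕ) :
    {a : ι → L | a ∈ Fintype.piFinset A ∧ ∃ ψ : L → ℝ,
        (∀ (j j' : ι), ∀ l₁ ∈ A j, ∀ l₂ ∈ A j, ∀ l₃ ∈ A j', ∀ l₄ ∈ A j',
          (φ l₁ - φ l₂ < φ l₃ - φ l₄ ↔ ψ l₁ - ψ l₂ < ψ l₃ - ψ l₄)) ∧
        Set.InjOn (Hw ψ) (Fintype.piFinset A : Set (ι → L)) ∧
        ((Fintype.piFinset A).filter fun b => Hw ψ a < Hw ψ b).card < k}.ncard ≤
      (Nat.log 2 k + 1) * (2 ^ (Nat.log 2 k + 1) * k ^ 2) ^ 2 := by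
  set N := Nat.log 2 k + 1 with hNdef
  set S := {a : ι → L | a ∈ Fintype.piFinset A ∧ ∃ ψ : L → ℝ,
        (∀ (j j' : ι), ∀ l₁ ∈ A j, ∀ l₂ ∈ A j, ∀ l₃ ∈ A j', ∀ l₄ ∈ A j',
          (φ l₁ - φ l₂ < φ l₃ - φ l₄ ↔ ψ l₁ - ψ l₂ < ψ l₃ - ψ l₄)) ∧
        Set.InjOn (Hw ψ) (Fintype.piFinset A : Set (ι → L)) ∧
        ((Fintype.piFinset A).filter fun b => Hw ψ a < Hw ψ b).card < k} with hS
  have hmaps : Set.MapsTo (fun a => ((dem A φ a).card, gcode N A φ a, lcode N A φ a)) S (codeSpace k N : Set _) := by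
    rintro a ⟨ha, ψ, hc, hψ, hk⟩
    have hd := card_dem_le_log hc hinj hψ ha hk
    have hdN : (dem A φ a).card ≤ N := hd.trans (Nat.le_succ _)
    refine Finset.mem_coe.mpr (Finset.mem_product.mpr ⟨Finset.mem_range.mpr (Nat.lt_succ_of_le hd),
      Finset.mem_product.mpr ⟨gcode_mem_Tset hc hinj hne ha hdN hk, lcode_mem_Tset hc hinj hne hψ ha hdN hk⟩⟩)
  have hinjS : Set.InjOn (fun a => ((dem A φ a).card, gcode N A φ a, lcode N A φ a)) S := by
    refine (code_injOn hinj hne N).mono ?_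
    rintro a ⟨ha, ψ, hc, hψ, hk⟩
    exact ⟨ha, (card_dem_le_log hc hinj hψ ha hk).trans (Nat.le_succ _)⟩
  calc S.ncard ≤ ((codeSpace k N : Finset _) : Set _).ncard :=
        Set.ncard_le_ncard_of_injOn _ (fun a ha => hmaps ha) hinjS (Finset.finite_toSet _)
    _ = (codeSpace k N).card := Set.ncard_coe_finset _
    _ ≤ (Nat.log 2 k + 1) * (2 ^ N * k ^ 2) ^ 2 := card_codeSpace_le k N

end

end Generic

/-- **Registered sub-goal (file `GenericCode`).**  The words of the box that are top-`k` for some word-height-injective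
height comparison-equivalent to `φ` number at most `(log₂ k + 1) · (2^(log₂ k + 1) k²)²`. -/
theorem generic_ncard_topWords_le {ι L : Type} [Fintype ι] [DecidableEq ι] [Inhabited L] [DecidableEq L] (A : ι → Finset L) (φ : L → ℝ) (hinj : Set.InjOn (Generic.Hw φ) (Fintype.piFinset A : Set (ι → L))) (hne : ∀ j, (A j).Nonempty) (k : ℕ) : {a : ι → L | a ∈ Fintype.piFinset A ∧ ∃ ψ : L → ℝ, (∀ (j j' : ι), ∀ l₁ ∈ A j, ∀ l₂ ∈ A j, ∀ l₃ ∈ A j', ∀ l₄ ∈ A j', (φ l₁ - φ l₂ < φ l₃ - φ l₄ ↔ ψ l₁ - ψ l₂ < ψ l₃ - ψ l₄)) ∧ Set.InjOn (Generic.Hw ψ) (Fintype.piFinset A : Set (ι → L)) ∧ ((Fintype.piFinset A).filter fun b => Generic.Hw ψ a < Generic.Hw ψ b).card < k}.ncard ≤ (Nat.log 2 k + 1) * (2 ^ (Nat.log 2 k + 1) * k ^ 2) ^ 2 :=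
  Generic.ncard_topWords_le hinj hne k

end Summit.ValiantsHypothesis.ValiantsHypothesis.Theorems.NewtonUnitEquationsDissociatedUniform
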